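import Literature.MathematicalPhysics.QuantumFieldTheory.Balaban1983to89.B7Prop1Explicit

/-!
# AbelianBlockAverage (T⁴ programme, node NE3, crew item (s4b) of the owner skeleton v1.1, PART 1b) — Bałaban's block
# average (42) in the ABELIAN case is EXACTLY `exp` of the linear contour average `T_c = X̂_c + A(Γ_c)`

HONEST FRAMING (cell `pub-balaban`, T4-DAG PAGE 1; unit `b2b-balaban-t4-ne3-formalise-leaf-03` = NE3 formalisation
swarm, leaf prover 03; claim CLAIMS.log l.7100).  The cell's T⁴ target is the finite-torus continuum limit of
gauge-invariant observables — NOT infinite volume, NO mass gap, NOT Clay, NOT summit progress.  Row NE3 (node U1b) is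
NOT proved by anything here; its reading (A) is CONDITIONAL on ⟨`MinimalActionRate.SandwichData` /
`MinimalActionRefine.SmoothRefine`⟩ (owner skeleton `t4/b2b-balaban-t4-ne3-p1/SKELETON-NE3-P1.md` v1.1 §3–§4), and this
file imports neither.  It is PURE LATTICE BOOKKEEPING about the tree's concrete average `B7Prop1Explicit.bavg` ((42)
p. 23 of T. Bałaban, *Averaging operations for lattice gauge theories*, Commun. Math. Phys. **98** (1985) 17–51
[Balaban1985Averaging]) and its linearisation `Tside`/`Xhat` (the displays before (47) and (47)–(48) p. 25, tree), in a
COMMUTATIVE coefficient algebra — the abelian sanity case of the kinematic refinement lemma (skeleton §3 leaf R1, §6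
(s4b)).  No printed sentence is a hypothesis of any declaration; nothing about Bałaban's minimisers is asserted.
Companion: `BlockAverageLoopFlux` (the loop-flux formula for `Xhat`, the constant-flux value `X₀` with its sign).

CONTENT (all [folklore], 0 sorry).  §1 `norm_asum_loop_le`: every loop sum of (42) has norm `≤ (2dL + 2L)·a` from a
bond bound `‖A_b‖ ≤ a` (tree `norm_asum_le`, `length_gammaWord`, `l1_boxVec_le`; any normed ring).  §2 in a COMMUTATIVE
complete normed `ℂ`-algebra, for `W = exp ∘ A` bondwise (`fun y μ => expUnit (A y μ)`): `hol W x w = expUnit (A(w))`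
(`hol_expUnit`), `Wcx = expUnit (A(loop))` (`Wcx_expUnit`), and inside the ball of the logarithm (`‖A(loop_r)‖ < ln 2`
for every `r`; §1) `Xavg L W q κ = Xhat L A q κ` (`Xavg_expUnit`, tree `B7BlockAvgLog.mlog_exp`) and
**`bavg L W q κ = expUnit (Tside L A q κ) = expUnit (Xhat L A q κ + A(Γ_c))`** (`bavg_expUnit`, `bavg_expUnit'`): the
coarse bond is `exp` of (straight line sum + `X̂_c`) — to hit a prescribed coarse value `exp(u_c)` the fine line sum
must be PRE-COMPENSATED to `u_c − X̂_c` (skeleton §2 ¶3 «pre-compensated target `T = exp(−X₀)·U_A`», abelian form).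
What is NOT here: the refinement construction itself (PART 2 of (s4b)), anything non-abelian, anything about
minimisers.  PLACEMENT: `Summits/QuantumFields/BalabanUV/` (human rule 2026-08-19).  Record: HOME
`t4/b2b-balaban-t4-ne3-formalise-leaf-03/`.
HONEST DEPENDENCY (cell, verbatim): continuum YM on T⁴ ⇐ BetaPertH ∧ nine spine estimates (0/9 proved); BetaPertH ⇐
(D1) ∧ (D4) ∧ CAP+tail; G-an2-4 gates asym, D1 and NE2/3/4.
-/

set_option autoImplicit false

open scoped BigOperators
open NormedSpace Finset

namespace Summit.QuantumFields.BalabanUV.T4Continuum.AbelianBlockAverage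

open Literature.MathematicalPhysics.QuantumFieldTheory.Balaban1983to89
open B7Prop1Explicit

noncomputable section

variable {d : ℕ}

/-! ## §1 Smallness of the loop sums from a bond bound -/

section Loop

variable {𝔸 : Type*} [NormedRing 𝔸]

/-- Smallness from a bond bound: if `‖A_b‖ ≤ a` on the bonds within `|·|₁`-distance `2dL + 2L` of `q` then every
loop sum of (42) has norm `≤ (2dL + 2L)·a` (tree `norm_asum_le`, `length_gammaWord`, `l1_boxVec_le`). [folklore] -/
theorem norm_asum_loop_le (L : ℕ) (A : Site d → Fin d → 𝔸) (q : Site d) (κ : Fin d) {a : ℝ} (ha : 0 ≤ a)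
    (hA : ∀ (x : Site d) (μ : Fin d), l1 (x - q) ≤ 2 * (d * L) + L + L → ‖A x μ‖ ≤ a) (r : Fin d → Fin L) :
    ‖asum A q (gammaWord L κ (boxVec L r) ++ seg κ (-(L : ℤ)))‖ ≤ ((2 * (d * L) + L + L : ℕ) : ℝ) * a := by
  have hlen : (gammaWord L κ (boxVec L r) ++ seg κ (-(L : ℤ))).length ≤ 2 * (d * L) + L + L := by
    rw [List.length_append, length_gammaWord, length_seg]
    have := l1_boxVec_le L r
    simp only [Int.natAbs_neg, Int.natAbs_natCast]
    nlinarith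
  have h := norm_asum_le A q (2 * (d * L) + L + L) ha hA (gammaWord L κ (boxVec L r) ++ seg κ (-(L : ℤ))) q
    (by rw [sub_self]; simp only [l1, Pi.zero_apply, Int.natAbs_zero, Finset.sum_const_zero, zero_add]; exact hlen)
  refine h.trans (mul_le_mul_of_nonneg_right ?_ ha)
  exact_mod_cast hlen

end Loop

/-! ## §2 The abelian average exactly: `V̄_c = exp(T_c) = exp(X̂_c + A(Γ_c))` -/

section Comm

variable {𝔸 : Type*} [NormedCommRing 𝔸] [NormedAlgebra ℂ 𝔸] [CompleteSpace 𝔸]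

/-- One letter of `W = exp ∘ A`: `W(l) = exp(±A_b)`. [folklore] -/
theorem stepHol_expUnit (A : Site d → Fin d → 𝔸) (x : Site d) (l : Letter d) :
    stepHol (fun y μ => expUnit (A y μ)) x l = expUnit (stepA A x l) := by
  obtain ⟨μ, b⟩ := l
  cases b
  · simp only [stepHol, stepA, Bool.false_eq_true, ↓reduceIte]
    exact val_inv_expUnit _
  · simp [stepHol, stepA]

/-- **Abelian parallel transport**: in a commutative algebra `(exp ∘ A)(Γ) = exp(A(Γ))` along every word. [folklore] -/
theorem hol_expUnit (A : Site d → Fin d → 𝔸) : ∀ (x : Site d) (w : List (Letter d)),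
    hol (fun y μ => expUnit (A y μ)) x w = expUnit (asum A x w)
  | x, [] => by
    apply Units.ext
    simp [expUnit]
  | x, l :: w => by
    rw [hol_cons, asum_cons, stepHol_expUnit, hol_expUnit A (x + l.vec) w]
    apply Units.ext
    letI : NormedAlgebra ℚ 𝔸 := NormedAlgebra.restrictScalars ℚ ℂ 𝔸
    simp only [Units.val_mul, val_expUnit]
    rw [exp_add_of_commute (Commute.all _ _)]

/-- The loop variables of (42) in the abelian case: `W(Γ_{c,x})W(c)⁻¹ = exp(A(Γ_{c,x} ∪ (−Γ_c)))`. [folklore] -/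
theorem Wcx_expUnit (L : ℕ) (A : Site d → Fin d → 𝔸) (q : Site d) (κ : Fin d) (r : Site d) :
    Wcx L (fun y μ => expUnit (A y μ)) q κ r = expUnit (asum A q (gammaWord L κ r ++ seg κ (-(L : ℤ)))) := by
  rw [Wcx_eq_hol_loop, hol_expUnit]

/-- The exponent of (42) in the abelian case, inside the ball of the logarithm: `X_c = X̂_c` EXACTLY
(the second-order terms of p. 25 vanish). [folklore] -/
theorem Xavg_expUnit (L : ℕ) (A : Site d → Fin d → 𝔸) (q : Site d) (κ : Fin d)
    (hsmall : ∀ r : Fin d → Fin L, ‖asum A q (gammaWord L κ (boxVec L r) ++ seg κ (-(L : ℤ)))‖ < Real.log 2) :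
    Xavg L (fun y μ => expUnit (A y μ)) q κ = Xhat L A q κ := by
  unfold Xavg Xhat
  refine Finset.sum_congr rfl fun r _ => ?_
  rw [Wcx_expUnit, val_expUnit, B7BlockAvgLog.mlog_exp (hsmall r)]

/-- **THE ABELIAN AVERAGE (42) EXACTLY**: `V̄_c = exp(T_c)`, `T_c = Σ_x L^{−d} A(Γ_{c,x})` the linear contour
average (tree `Tside`; (47)–(48) p. 25 become identities). [folklore] -/
theorem bavg_expUnit (L : ℕ) (hL : 1 ≤ L) (A : Site d → Fin d → 𝔸) (q : Site d) (κ : Fin d)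
    (hsmall : ∀ r : Fin d → Fin L, ‖asum A q (gammaWord L κ (boxVec L r) ++ seg κ (-(L : ℤ)))‖ < Real.log 2) :
    bavg L (fun y μ => expUnit (A y μ)) q κ = expUnit (Tside L A q κ) := by
  apply Units.ext
  letI : NormedAlgebra ℚ 𝔸 := NormedAlgebra.restrictScalars ℚ ℂ 𝔸
  rw [show bavg L (fun y μ => expUnit (A y μ)) q κ
      = expUnit (Xavg L (fun y μ => expUnit (A y μ)) q κ) * hol (fun y μ => expUnit (A y μ)) q (seg κ L) from rfl,
    Xavg_expUnit L A q κ hsmall, hol_expUnit, Units.val_mul, val_expUnit, val_expUnit, val_expUnit,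
    ← exp_add_of_commute (Commute.all _ _), Xhat_eq L hL, sub_add_cancel]

/-- The same, displayed as PRE-COMPENSATION: `V̄_c = exp(X̂_c + A(Γ_c))` — the coarse bond is `exp` of (straight line
sum + `X̂_c`), so a prescribed coarse value `exp(u_c)` is hit by the line sum `u_c − X̂_c`. [folklore] -/
theorem bavg_expUnit' (L : ℕ) (hL : 1 ≤ L) (A : Site d → Fin d → 𝔸) (q : Site d) (κ : Fin d)
    (hsmall : ∀ r : Fin d → Fin L, ‖asum A q (gammaWord L κ (boxVec L r) ++ seg κ (-(L : ℤ)))‖ < Real.log 2) :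
    bavg L (fun y μ => expUnit (A y μ)) q κ = expUnit (Xhat L A q κ + asum A q (seg κ L)) := by
  rw [bavg_expUnit L hL A q κ hsmall, Xhat_eq L hL, sub_add_cancel]

end Comm

end

end Summit.QuantumFields.BalabanUV.T4Continuum.AbelianBlockAverage
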